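import Literature.Analysis.FluidPDE.Seregin2020BlowupLimitAlong
import HarnessLib

/-!
# Compactness of a SEQUENCE of local energy ancient solutions, I: the level limits
# (tool for stub Z4 `stub_caseOneZoom` of the line `radius_dichotomy`, item `TerminalTrace.TypeITraceScarL3`,
# stmt-NavierStokesRegularity-18385)

Seat nsreg-C26-p1 g5 (cell ns-regularity-ideate), `--supports stmt-NavierStokesRegularity-18385`.

The tree's `exists_zoom_blowup_levels_along` / `exists_zoom_blowup_limit_along` (Seregin 2014, Prop. 6.20) extract the
zoom-in limit of ONE suitable weak solution at ONE point along a null sequence of scales.  The Case-1 zoom package of the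
line `radius_dichotomy` zooms at VARYING centres, i.e. it needs the same extraction for an arbitrary SEQUENCE
`(vₙ, pₙ)` of pairs which are suitable weak solutions in every parabolic ball `Q_a(0)` with `C(vₙ; 0, a) ≤ M`,
`D(pₙ; 0, a) ≤ D` for all `a > 0`.  This file is the first half, VERBATIM the tree's level extraction with the zooms
`u^{2ᵐ rₙ}` of one solution replaced by the `2ᵐ`-zoom-outs of `vₙ`:

* `eLpNorm_zoomOut_add_le` — `‖2ᵐ-zoom-out of vₙ‖_{L³(Q(1))} + ‖…pₙ‖_{L^{3/2}(Q(1))} ≤ M^{1/3} + D^{2/3}`;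
* `exists_seqLevels` — a diagonal subsequence `δ` and, for every level `m`, a pair `(w_m, π_m)` suitable in
  `Q(2ᵐ R)`, `0 < R < 1`, with `v_{δ j} → w_m` in `L³(Q(2ᵐ R))` and `p_{δ j} ⇀ π_m` weakly in `L^{3/2}(Q(2ᵐ R))`
  (`SuitableCompactness_holds` at each level on the zoom-outs, `exists_diagonal_subsequence`, and the level limits
  zoomed back to the base scale as in the tree's `exists_zoom_blowup_limit_along`, steps (A)–(B)).
WHAT THIS IS NOT: 18385 / NS regularity NOT proved. [cite: Seregin2014, §6.6 Prop. 6.20] [cite: AlbrittonBarker2019, Lemma 2.2]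
-/

noncomputable section

set_option linter.dupNamespace false

namespace Summit.NavierStokesRegularity.NavierStokesRegularity.Theorems.TypeITraceScarL3

open MeasureTheory Set Function Filter Topology TopologicalSpace Metric
open Literature.Analysis.FluidPDE
open scoped NNReal ENNReal

/-- `L³ × L^{3/2}` size on `Q(1)` of the `R`-zoom-out about the origin, from `C(v; 0, R) ≤ M` and `D(p; 0, R) ≤ D`
(any `R > 0`; the tree's `eLpNorm_zoom_add_le_of` is the case `R ≤ 1/2` about a general point). [folklore] -/
theorem eLpNorm_zoomOut_add_le
    {v : ℝ → EuclideanSpace ℝ (Fin 3) → EuclideanSpace ℝ (Fin 3)} {p : ℝ → EuclideanSpace ℝ (Fin 3) → ℝ}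
    {M D : ℝ≥0} {R : ℝ} (hR : 0 < R)
    (hM : cknC R (0 : ℝ × EuclideanSpace ℝ (Fin 3)) v ≤ M)
    (hD : cknD R (0 : ℝ × EuclideanSpace ℝ (Fin 3)) p ≤ D) :
    eLpNorm (uncurry (R • stPull (R ^ 2) R (0 : ℝ) (0 : EuclideanSpace ℝ (Fin 3)) v)) 3
        (volume.restrict (parabolicCylinder 1 (0 : ℝ × EuclideanSpace ℝ (Fin 3)))) +
      eLpNorm (uncurry (R ^ 2 • stPull (R ^ 2) R (0 : ℝ) (0 : EuclideanSpace ℝ (Fin 3)) p)) (3 / 2)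
        (volume.restrict (parabolicCylinder 1 (0 : ℝ × EuclideanSpace ℝ (Fin 3)))) ≤
      (M : ℝ≥0∞) ^ (1 / 3 : ℝ) + (D : ℝ≥0∞) ^ (2 / 3 : ℝ) := by
  have hcube := lintegral_cube_zoom hR (0 : ℝ × EuclideanSpace ℝ (Fin 3)) v
  have hpress := lintegral_pressure_zoom hR (0 : ℝ × EuclideanSpace ℝ (Fin 3)) p
  simp only [Prod.fst_zero, Prod.snd_zero] at hcube hpress
  refine add_le_add ?_ ?_
  · rw [eLpNorm_eq_lintegral_rpow_enorm_toReal (by norm_num) (by norm_num)]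
    have e : (3 : ℝ≥0∞).toReal = 3 := by norm_num
    rw [e, show (1 / 3 : ℝ) = 1 / 3 from rfl]
    refine ENNReal.rpow_le_rpow ?_ (by norm_num)
    have h1 : ∫⁻ w in parabolicCylinder 1 (0 : ℝ × EuclideanSpace ℝ (Fin 3)),
        ‖(R • stPull (R ^ 2) R (0 : ℝ) (0 : EuclideanSpace ℝ (Fin 3)) v) w.1 w.2‖ₑ ^ (3 : ℕ) ≤ M := by
      rw [hcube]
      exact hM
    refine le_trans (le_of_eq ?_) h1
    refine lintegral_congr fun w => ?_
    rw [show (3 : ℝ) = ((3 : ℕ) : ℝ) by norm_num, ENNReal.rpow_natCast]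
    rfl
  · rw [eLpNorm_eq_lintegral_rpow_enorm_toReal (by norm_num)
      (ENNReal.div_ne_top (by norm_num) (by norm_num))]
    have e : (3 / 2 : ℝ≥0∞).toReal = 3 / 2 := by
      rw [ENNReal.toReal_div]; norm_num
    rw [e, show (1 / (3 / 2) : ℝ) = 2 / 3 by norm_num]
    refine ENNReal.rpow_le_rpow ?_ (by norm_num)
    have h1 : ∫⁻ w in parabolicCylinder 1 (0 : ℝ × EuclideanSpace ℝ (Fin 3)),
        ‖(R ^ 2 • stPull (R ^ 2) R (0 : ℝ) (0 : EuclideanSpace ℝ (Fin 3)) p) w.1 w.2‖ₑ ^ (3 / 2 : ℝ) ≤ D := by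
      rw [hpress]
      exact hD
    exact h1

set_option maxHeartbeats 1600000 in
/-- **Level limits of a sequence of local energy ancient solutions** (Seregin 2014, Prop. 6.20, extraction step, for a
SEQUENCE): let `(vₙ, pₙ)` be suitable weak solutions in every `Q_a(0)` with `C(vₙ; 0, a) ≤ M`, `D(pₙ; 0, a) ≤ D` for
all `a > 0`.  There are a strictly increasing `δ`, `δ(k) ≥ k`, and for every level `m` a pair `(w_m, π_m)` such that
for `0 < R < 1`: `(w_m, π_m)` is suitable in `Q(2ᵐ R)`, `w_m ∈ L³`, `π_m ∈ L^{3/2}` there, `v_{δ j} → w_m` in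
`L³(Q(2ᵐ R))` and `∫ p_{δ j} g → ∫ π_m g` for every `g ∈ L³(Q(2ᵐ R))`.  Proof: verbatim the tree's
`exists_zoom_blowup_levels_along` on the `2ᵐ`-zoom-outs (`SuitableCompactness_holds` at each level,
`exists_diagonal_subsequence`), then steps (A)–(B) of `exists_zoom_blowup_limit_along` (the level limits zoomed back).
[cite: Seregin2014, §6.6 Prop. 6.20] [cite: AlbrittonBarker2019, Lemma 2.2] -/
theorem exists_seqLevels
    {v : ℕ → ℝ → EuclideanSpace ℝ (Fin 3) → EuclideanSpace ℝ (Fin 3)} {p : ℕ → ℝ → EuclideanSpace ℝ (Fin 3) → ℝ}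
    (hsw : ∀ n (a : ℝ), 0 < a →
      IsSuitableWeakSolutionInBall a (0 : ℝ × EuclideanSpace ℝ (Fin 3)) (v n) (p n))
    {M D : ℝ≥0} (hM : ∀ n (a : ℝ), 0 < a → cknC a (0 : ℝ × EuclideanSpace ℝ (Fin 3)) (v n) ≤ M)
    (hD : ∀ n (a : ℝ), 0 < a → cknD a (0 : ℝ × EuclideanSpace ℝ (Fin 3)) (p n) ≤ D) :
    ∃ δ : ℕ → ℕ, StrictMono δ ∧ (∀ k, k ≤ δ k) ∧ ∀ m : ℕ,
      ∃ (wl : ℝ → EuclideanSpace ℝ (Fin 3) → EuclideanSpace ℝ (Fin 3)) (πl : ℝ → EuclideanSpace ℝ (Fin 3) → ℝ),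
        ∀ R ∈ Ioo (0 : ℝ) 1,
        IsSuitableWeakSolutionInBall ((2 : ℝ) ^ m * R) 0 wl πl ∧
        MemLp (uncurry wl) 3
          (volume.restrict (parabolicCylinder ((2 : ℝ) ^ m * R) (0 : ℝ × EuclideanSpace ℝ (Fin 3)))) ∧
        MemLp (uncurry πl) (3 / 2)
          (volume.restrict (parabolicCylinder ((2 : ℝ) ^ m * R) (0 : ℝ × EuclideanSpace ℝ (Fin 3)))) ∧
        Tendsto (fun j => eLpNorm (uncurry (v (δ j)) - uncurry wl) 3
            (volume.restrict (parabolicCylinder ((2 : ℝ) ^ m * R) (0 : ℝ × EuclideanSpace ℝ (Fin 3)))))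
          atTop (𝓝 0) ∧
        ∀ g : ℝ × EuclideanSpace ℝ (Fin 3) → ℝ,
          MemLp g 3 (volume.restrict (parabolicCylinder ((2 : ℝ) ^ m * R) (0 : ℝ × EuclideanSpace ℝ (Fin 3)))) →
          Tendsto (fun j => ∫ w in parabolicCylinder ((2 : ℝ) ^ m * R) (0 : ℝ × EuclideanSpace ℝ (Fin 3)),
              (p (δ j)) w.1 w.2 * g w) atTop
            (𝓝 (∫ w in parabolicCylinder ((2 : ℝ) ^ m * R) (0 : ℝ × EuclideanSpace ℝ (Fin 3)), πl w.1 w.2 * g w)) := by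
  classical
  -- ## abbreviations: the `2ᵐ`-zoom-outs, the cylinders' measures, goodness
  set cc : ℕ → ℝ := fun m => (2 : ℝ) ^ m with hcc
  have hcc_pos : ∀ m, 0 < cc m := fun m => by positivity
  set Z : ℕ → (ℝ → EuclideanSpace ℝ (Fin 3) → EuclideanSpace ℝ (Fin 3)) →
      (ℝ → EuclideanSpace ℝ (Fin 3) → EuclideanSpace ℝ (Fin 3)) :=
    fun m f => cc m • stPull (cc m ^ 2) (cc m) (0 : ℝ) (0 : EuclideanSpace ℝ (Fin 3)) f with hZ
  set Zp : ℕ → (ℝ → EuclideanSpace ℝ (Fin 3) → ℝ) → (ℝ → EuclideanSpace ℝ (Fin 3) → ℝ) :=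
    fun m g => cc m ^ 2 • stPull (cc m ^ 2) (cc m) (0 : ℝ) (0 : EuclideanSpace ℝ (Fin 3)) g with hZp
  set μ : ℝ → Measure (ℝ × EuclideanSpace ℝ (Fin 3)) :=
    fun R => volume.restrict (parabolicCylinder R (0 : ℝ × EuclideanSpace ℝ (Fin 3))) with hμ
  set Good : ℕ → (ℕ → ℕ) →
      ((ℝ → EuclideanSpace ℝ (Fin 3) → EuclideanSpace ℝ (Fin 3)) ×
        (ℝ → EuclideanSpace ℝ (Fin 3) → ℝ)) → Prop :=
    fun m ρ d => ∀ R ∈ Ioo (0 : ℝ) 1,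
      IsSuitableWeakSolutionInBall R 0 d.1 d.2 ∧ MemLp (uncurry d.1) 3 (μ R) ∧
      Tendsto (fun j => eLpNorm (uncurry (Z m (v (ρ j))) - uncurry d.1) 3 (μ R)) atTop (𝓝 0) ∧
      ∀ g : ℝ × EuclideanSpace ℝ (Fin 3) → ℝ, MemLp g 3 (μ R) →
        Tendsto (fun j => ∫ w in parabolicCylinder R (0 : ℝ × EuclideanSpace ℝ (Fin 3)),
            (Zp m (p (ρ j))) w.1 w.2 * g w) atTop
          (𝓝 (∫ w in parabolicCylinder R (0 : ℝ × EuclideanSpace ℝ (Fin 3)), d.2 w.1 w.2 * g w))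
    with hGood
  -- ## goodness is stable under subsequences
  have hsub : ∀ (m : ℕ) (ρ : ℕ → ℕ) d (φ : ℕ → ℕ), Good m ρ d → StrictMono φ →
      Good m (ρ ∘ φ) d := by
    intro m ρ d φ hg hφ R hR
    obtain ⟨h1, h2, h3, h4⟩ := hg R hR
    exact ⟨h1, h2, h3.comp hφ.tendsto_atTop, fun g hg' => (h4 g hg').comp hφ.tendsto_atTop⟩
  -- ## extraction at one level (the compactness theorem)
  have hstep : ∀ (m : ℕ) (τ : ℕ → ℕ), StrictMono τ → (∀ k, m ≤ τ k) →
      ∃ σ : ℕ → ℕ, StrictMono σ ∧ ∃ d, Good m (τ ∘ σ) d := by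
    intro m τ _ _
    have hsuit : ∀ k, IsSuitableWeakSolutionInBall 1 0 (Z m (v (τ k))) (Zp m (p (τ k))) := by
      intro k
      have h := (hsw (τ k) (cc m) (hcc_pos m)).zoomOut (hcc_pos m)
      rwa [div_self (hcc_pos m).ne'] at h
    have hbound : (⨆ k, eLpNorm (uncurry (Z m (v (τ k)))) 3 (μ 1) +
        eLpNorm (uncurry (Zp m (p (τ k)))) (3 / 2) (μ 1)) < ∞ := by
      refine lt_of_le_of_lt (iSup_le fun k => eLpNorm_zoomOut_add_le (hcc_pos m)
        (hM (τ k) (cc m) (hcc_pos m)) (hD (τ k) (cc m) (hcc_pos m))) ?_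
      exact ENNReal.add_lt_top.2
        ⟨ENNReal.rpow_lt_top_of_nonneg (by norm_num) ENNReal.coe_ne_top,
          ENNReal.rpow_lt_top_of_nonneg (by norm_num) ENNReal.coe_ne_top⟩
    obtain ⟨u, q, σ, hσ, hconv⟩ :=
      SuitableCompactness_holds (fun k => Z m (v (τ k))) (fun k => Zp m (p (τ k))) hsuit hbound
    exact ⟨σ, hσ, (u, q), fun R hR => hconv R hR⟩
  -- ## the diagonal
  obtain ⟨δ, hδ, hδge, hgood⟩ := exists_diagonal_subsequence Good hsub hstep
  refine ⟨δ, hδ, hδge, fun m => ?_⟩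
  obtain ⟨⟨u, q⟩, hd⟩ := hgood m
  -- ## the level limit zoomed back to the base scale
  set wl : ℝ → EuclideanSpace ℝ (Fin 3) → EuclideanSpace ℝ (Fin 3) :=
    (cc m)⁻¹ • stPull ((cc m)⁻¹ ^ 2) (cc m)⁻¹ (0 : ℝ) (0 : EuclideanSpace ℝ (Fin 3)) u with hwl
  set πl : ℝ → EuclideanSpace ℝ (Fin 3) → ℝ :=
    (cc m)⁻¹ ^ 2 • stPull ((cc m)⁻¹ ^ 2) (cc m)⁻¹ (0 : ℝ) (0 : EuclideanSpace ℝ (Fin 3)) q with hπl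
  have hu_wl : u = cc m • stPull (cc m ^ 2) (cc m) (0 : ℝ) (0 : EuclideanSpace ℝ (Fin 3)) wl :=
    (zoom_zoom_origin_inv (hcc_pos m).ne' _ _ (mul_inv_cancel₀ (hcc_pos m).ne') u).symm
  have hq_πl : q = cc m ^ 2 • stPull (cc m ^ 2) (cc m) (0 : ℝ) (0 : EuclideanSpace ℝ (Fin 3)) πl :=
    (zoom_zoom_origin_inv (hcc_pos m).ne' _ _
      (by rw [← mul_pow, mul_inv_cancel₀ (hcc_pos m).ne', one_pow]) q).symm
  have hcyl : ∀ R : ℝ, parabolicCylinder R (0 : ℝ × EuclideanSpace ℝ (Fin 3)) =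
      parabolicCylinder ((cc m * R) / cc m) (0 : ℝ × EuclideanSpace ℝ (Fin 3)) := by
    intro R; rw [mul_div_cancel_left₀ R (hcc_pos m).ne']
  have hcyl' : ∀ R : ℝ, parabolicCylinder (R / (cc m)⁻¹) (0 : ℝ × EuclideanSpace ℝ (Fin 3)) =
      parabolicCylinder (cc m * R) (0 : ℝ × EuclideanSpace ℝ (Fin 3)) := by
    intro R; rw [div_inv_eq_mul, mul_comm]
  refine ⟨wl, πl, fun R hR => ?_⟩
  obtain ⟨h1, h2, h3, h4⟩ := hd R hR
  dsimp only at h1 h2 h3 h4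
  refine ⟨?_, ?_, ?_, ?_, ?_⟩
  · -- suitability on `Q(2ᵐ R)`
    have h5 := h1.zoomOut (inv_pos.2 (hcc_pos m))
    have e : R / (cc m)⁻¹ = cc m * R := by rw [div_inv_eq_mul, mul_comm]
    rw [e] at h5
    exact h5
  · -- `wl ∈ L³(Q(2ᵐ R))`
    have h5 := (memLp_comp_zoom (inv_pos.2 (hcc_pos m)) (by norm_num) (by norm_num) h2).const_smul
      (cc m)⁻¹
    rw [hcyl'] at h5
    exact h5
  · -- `πl ∈ L^{3/2}(Q(2ᵐ R))`
    have h5 := (memLp_comp_zoom (inv_pos.2 (hcc_pos m)) (by norm_num)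
      (ENNReal.div_ne_top (by norm_num) (by norm_num)) h1.2.2.2).const_smul ((cc m)⁻¹ ^ 2)
    rw [hcyl'] at h5
    exact h5
  · -- (A) strong convergence in the base scale on `Q(2ᵐ R)`
    have h3' : Tendsto (fun j => eLpNorm (uncurry (Z m (v (δ (j + m)))) - uncurry u) 3
        (volume.restrict (parabolicCylinder R (0 : ℝ × EuclideanSpace ℝ (Fin 3))))) atTop (𝓝 0) := h3
    set K : ℝ≥0∞ := ‖cc m‖ₑ * (ENNReal.ofReal (cc m ^ 2 * cc m ^ 3)⁻¹) ^ (1 / (3 : ℝ≥0∞).toReal)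
      with hK
    have key : ∀ j, eLpNorm (uncurry (Z m (v (δ (j + m)))) - uncurry u) 3
        (volume.restrict (parabolicCylinder R (0 : ℝ × EuclideanSpace ℝ (Fin 3)))) =
        K * eLpNorm (uncurry (v (δ (j + m))) - uncurry wl) 3
          (volume.restrict (parabolicCylinder (cc m * R) (0 : ℝ × EuclideanSpace ℝ (Fin 3)))) := by
      intro j
      rw [hu_wl]
      have e1 : uncurry (Z m (v (δ (j + m)))) -
          uncurry (cc m • stPull (cc m ^ 2) (cc m) (0 : ℝ) (0 : EuclideanSpace ℝ (Fin 3)) wl) =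
          uncurry (cc m • stPull (cc m ^ 2) (cc m) (0 : ℝ) (0 : EuclideanSpace ℝ (Fin 3))
            (v (δ (j + m)) - wl)) := by
        funext z
        show _ - _ = cc m • (v (δ (j + m)) - wl) _ _
        rw [Pi.sub_apply, Pi.sub_apply, smul_sub]
        rfl
      rw [e1, hcyl R, eLpNorm_uncurry_zoom (hcc_pos m) (cc m) _ (cc m * R) (by norm_num)
        (by norm_num)]
      rfl
    have hK0 : K ≠ 0 := by
      refine mul_ne_zero ?_ ?_
      · rw [Real.enorm_eq_ofReal (hcc_pos m).le]; exact (ENNReal.ofReal_pos.2 (hcc_pos m)).ne'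
      · exact (ENNReal.rpow_pos (ENNReal.ofReal_pos.2 (by positivity)) ENNReal.ofReal_ne_top).ne'
    have hKtop : K ≠ ⊤ :=
      ENNReal.mul_ne_top enorm_ne_top (ENNReal.rpow_ne_top_of_nonneg (by positivity) ENNReal.ofReal_ne_top)
    simp only [key] at h3'
    have h4' := ENNReal.Tendsto.const_mul h3' (Or.inr (ENNReal.inv_ne_top.2 hK0)) (a := K⁻¹)
    simp only [mul_zero, ← mul_assoc, ENNReal.inv_mul_cancel hK0 hKtop, one_mul] at h4'
    exact (tendsto_add_atTop_iff_nat (f := fun j => eLpNorm (uncurry (v (δ j)) - uncurry wl) 3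
      (volume.restrict (parabolicCylinder (cc m * R) (0 : ℝ × EuclideanSpace ℝ (Fin 3))))) m).1 h4'
  · -- (B) weak convergence of the pressures in the base scale on `Q(2ᵐ R)`
    intro g hg
    have hg' : MemLp (g ∘ stAffine (cc m ^ 2) (cc m) (0 : ℝ) (0 : EuclideanSpace ℝ (Fin 3))) 3
        (volume.restrict (parabolicCylinder R (0 : ℝ × EuclideanSpace ℝ (Fin 3)))) := by
      rw [hcyl R]
      exact memLp_comp_zoom (hcc_pos m) (by norm_num) (by norm_num) hg
    have h5 : Tendsto (fun j => ∫ w in parabolicCylinder R (0 : ℝ × EuclideanSpace ℝ (Fin 3)),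
        (Zp m (p (δ (j + m)))) w.1 w.2 *
          (g ∘ stAffine (cc m ^ 2) (cc m) (0 : ℝ) (0 : EuclideanSpace ℝ (Fin 3))) w) atTop
        (𝓝 (∫ w in parabolicCylinder R (0 : ℝ × EuclideanSpace ℝ (Fin 3)),
          q w.1 w.2 * (g ∘ stAffine (cc m ^ 2) (cc m) (0 : ℝ) (0 : EuclideanSpace ℝ (Fin 3))) w)) :=
      h4 _ hg'
    set K : ℝ := cc m ^ 2 * (cc m ^ 2 * cc m ^ 3)⁻¹ with hK
    have hK0 : K ≠ 0 := by positivity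
    have key : ∀ ρ : ℝ → EuclideanSpace ℝ (Fin 3) → ℝ,
        ∫ w in parabolicCylinder R (0 : ℝ × EuclideanSpace ℝ (Fin 3)),
          (cc m ^ 2 • stPull (cc m ^ 2) (cc m) (0 : ℝ) (0 : EuclideanSpace ℝ (Fin 3)) ρ) w.1 w.2 *
            (g ∘ stAffine (cc m ^ 2) (cc m) (0 : ℝ) (0 : EuclideanSpace ℝ (Fin 3))) w =
          K * ∫ w in parabolicCylinder (cc m * R) (0 : ℝ × EuclideanSpace ℝ (Fin 3)),
            ρ w.1 w.2 * g w := by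
      intro ρ
      rw [hcyl R]
      exact setIntegral_zoom_pressure_mul (hcc_pos m) _ ρ g (cc m * R)
    have hZp' : ∀ j, Zp m (p (δ (j + m))) =
        cc m ^ 2 • stPull (cc m ^ 2) (cc m) (0 : ℝ) (0 : EuclideanSpace ℝ (Fin 3)) (p (δ (j + m))) :=
      fun j => rfl
    simp only [hZp', hq_πl, key] at h5
    have h6 := h5.const_mul K⁻¹
    simp only [← mul_assoc, inv_mul_cancel₀ hK0, one_mul] at h6
    exact (tendsto_add_atTop_iff_nat (f := fun j => ∫ w in parabolicCylinder (cc m * R)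
      (0 : ℝ × EuclideanSpace ℝ (Fin 3)), (p (δ j)) w.1 w.2 * g w) m).1 h6

/-- The uniform `L³ × L^{3/2}` bound of `eLpNorm_zoomOut_add_le` is finite (the form `SuitableCompactness` consumes).
[folklore] -/
theorem eLpNorm_zoomOut_add_lt_top
    {v : ℝ → EuclideanSpace ℝ (Fin 3) → EuclideanSpace ℝ (Fin 3)} {p : ℝ → EuclideanSpace ℝ (Fin 3) → ℝ}
    {M D : ℝ≥0} {R : ℝ} (hR : 0 < R)
    (hM : cknC R (0 : ℝ × EuclideanSpace ℝ (Fin 3)) v ≤ M)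
    (hD : cknD R (0 : ℝ × EuclideanSpace ℝ (Fin 3)) p ≤ D) :
    eLpNorm (uncurry (R • stPull (R ^ 2) R (0 : ℝ) (0 : EuclideanSpace ℝ (Fin 3)) v)) 3
        (volume.restrict (parabolicCylinder 1 (0 : ℝ × EuclideanSpace ℝ (Fin 3)))) +
      eLpNorm (uncurry (R ^ 2 • stPull (R ^ 2) R (0 : ℝ) (0 : EuclideanSpace ℝ (Fin 3)) p)) (3 / 2)
        (volume.restrict (parabolicCylinder 1 (0 : ℝ × EuclideanSpace ℝ (Fin 3)))) < ∞ :=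
  lt_of_le_of_lt (eLpNorm_zoomOut_add_le hR hM hD) (ENNReal.add_lt_top.2
    ⟨ENNReal.rpow_lt_top_of_nonneg (by norm_num) ENNReal.coe_ne_top,
      ENNReal.rpow_lt_top_of_nonneg (by norm_num) ENNReal.coe_ne_top⟩)

end Summit.NavierStokesRegularity.NavierStokesRegularity.Theorems.TypeITraceScarL3

end
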